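import Literature.Barriers.CriticalPhenomena.RigorousRGSmallParameterReblocking
import Literature.Barriers.CriticalPhenomena.RigorousRGSmallParameterKChangeOfVariables
import HarnessLib

/-!
# `RigorousRGSmallParameter` (Slade, Theorem 1.4.1): the renormalisation group map
# `K ↦ K₊ = Map 6 ∘ ⋯ ∘ Map 1 (K)` and its representation identity
# `𝔼₊θ(I ∘ K)(Λ) = e^{-δu₊|Λ|}(I₊ ∘ K₊)(Λ)` ([BS-rg-step] §3.1, Slade §6.3)

Companion ("proof architecture") file of
`Literature/Barriers/CriticalPhenomena/RigorousRGSmallParameter.lean`. Slade §6.3: "The RG map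
`U₊ : 𝔻 → 𝒰`, `K₊ : 𝔻 → 𝒦₊(Λ)` is such that `(V,K) ∈ 𝔻_j` determine `U₊(V,K) = (δu₊, V₊)` and
`K₊ = K₊(V,K)`, with `I = I(V)` and `I₊ = I₊(V₊)`, with the property that
`𝔼₊θ(I ∘ K)(Λ) = e^{-δu₊|Λ|}(I₊ ∘ K₊)(Λ)`. The maps are defined in [BS-rg-step]." [BS-rg-step]
§3.1: "We construct `K₊` as a composition of six maps (Map i) : `K^{(i-1)} ↦ K^{(i)}`, `i = 1,…,6`,
with `K^{(0)} = K`, `K^{(6)} = K₊` … `(I ∘ K)(Λ) = (I ∘ K^{(1)})(Λ) = (Î ∘ K^{(2)})(Λ)` …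
`𝔼₊θ(Î ∘ K^{(2)})(Λ) = (Ĩ_pt ∘ K^{(3)})(Λ)` … `(Ĩ_pt ∘ K^{(3)})(Λ) = (Ĩ_pt ∘ K^{(4)})(Λ)` …
`(Ĩ_pt ∘ K^{(4)})(Λ) = (I_pt⁺ ∘ K^{(5)})(Λ) = e^{δq σσ̄}(I₊ ∘ K₊)(Λ)` … The combination … gives
`𝔼₊θ(I ∘ K)(Λ) = e^{δq σσ̄}(I₊ ∘ K₊)(Λ)`, which is (rgmapdef-bis)." In Slade's setting (`n ≥ 1`
components, local polynomials `gτ² + ντ + u`, no gradient monomials and no observables) Map 6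
reduces to pulling the constant `e^{-δu₊|X|}` of `V_pt = V₊ + δu₊` out of the circle product.

This file DEFINES the composite, abstractly over the step data (`StepData`: `I = I_j(V)`,
`Î = I_j(V̂)`, `Ĩ_pt`, `I_pt⁺`, `I₊ = I_{j+1}(V₊)`, the Map-1 transfer `J`, the Map-4 transfer
`h = h_ldg`, `c = e^{-δu₊}`, `c' = e^{δu₊}`) and the operators (`θ, ι` ring maps into the algebra with
fluctuation fields, `E = 𝔼₊`), using `kout` (Maps 1, 4; `…KChangeOfVariables`), the binomial
lemma (Maps 2, 5) and `kthree` (Map 3; `…Reblocking`): **`kOne`, `kTwo`, `kThree`, `kFour`, `kFive`,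
`kPlus`**, and PROVES the representation identity **`expect_theta_circ_eq_kPlus`**:
`E(θ((I ∘ K)(Λ))) = c^{|Λ|} · (I₊ ∘₊ K₊)(Λ)` under the hypotheses: `K ∈ 𝒦_j` factorises, `J` is
supported on `𝒟_j`, `E` is `𝒩`-linear on admissible combinations (the Map-3 terms being
admissible), `K^{(3)}` factorises at scale `j+1` (the finite-range input, cf.
`…ReblockingFactorisation`), `h` is supported on `𝒟_{j+1}`, `I_pt⁺(B) = e^{-δu₊|B|}I₊(B)`,
`L^j ∣ L^{j+1}`. Also: `blockProd_refine` (regarding `Ĩ_pt` as a `(j+1)`-block activity),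
`blockProd_pow_card_mul`, **`circ_blockProd_pow_card_mul`** (Map 6 for the constant monomial).

Not treated here: the concrete step data as functions of `(V, K, m²)` (Loc, `V_pt`, `W_{j+1}`,
`h_ldg` via truncated expectations) and all estimates of Theorem 6.3.1.

Sources: D. C. Brydges, G. Slade, J. Stat. Phys. 159 (2015) 589–667, arXiv:1403.7256, §3.1
((3.1)–(3.8)), §4.2–§6.2 (Maps 1–6); G. Slade, arXiv:1611.06169, §6.3.

## References

* [BrydgesSlade2015RGV] D. C. Brydges, G. Slade, *A renormalisation group method. V. A single
  renormalisation group step*, J. Stat. Phys. **159** (2015) 589–667, arXiv:1403.7256.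
* [Slade2017] G. Slade, *Critical exponents for long-range O(n) models below the upper critical
  dimension*, Commun. Math. Phys. **358** (2018) 343–436, arXiv:1611.06169.
-/

noncomputable section

open Finset

namespace Literature.Barriers.CriticalPhenomena

namespace LongRangePhi4

namespace Polymer

open Literature.Probability.LatticeModels

variable {d M : ℕ} [NeZero M]


/-! ## Maps 5–6 and the composite RG map `K ↦ K₊` with its representation identity -/

section Composite

variable {A N : Type*} [CommRing A] [CommRing N]

/-- **Refinement of the background**: for `b ∣ b'` and a `b'`-polymer `X`,
`∏_{b-blocks of X} Ĩ = ∏_{B ∈ ℬ_{b'}(X)} ∏_{b-blocks of B} Ĩ` ("a slight abuse of notation, in which we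
regard `Ĩ_pt` as the element of `ℬ𝒦_{j+1}` defined for `B ∈ ℬ_{j+1}` by `Ĩ_pt(B) = ∏_{b ∈ ℬ_j(B)} Ĩ_pt(b)`").
[cite: BrydgesSlade2015RGV, §3.1 (after (KImaps3))] -/
theorem blockProd_refine {b b' : ℕ} (hbb : b ∣ b') (F : Finset (TorusSite d M) → A) {X : Finset (TorusSite d M)}
    (hX : IsPolymer b' X) : blockProd b F X = blockProd b' (fun B => blockProd b F B) X := by
  classical
  unfold blockProd
  have hpart : blocksOf b X = (blocksOf b' X).biUnion (blocksOf b) := by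
    ext B
    simp only [mem_biUnion]
    constructor
    · intro hB
      obtain ⟨x, hx, rfl⟩ := exists_eq_block_of_mem_blocksOf hB
      exact ⟨block b' x, mem_image_of_mem _ hx, mem_image_of_mem _ (mem_block_self b' x)⟩
    · rintro ⟨B', hB', hBB'⟩
      obtain ⟨x, hx, rfl⟩ := exists_eq_block_of_mem_blocksOf hB'
      obtain ⟨y, hy, rfl⟩ := exists_eq_block_of_mem_blocksOf hBB'
      exact mem_image_of_mem _ (hX hx hy)
  rw [hpart, Finset.prod_biUnion]
  intro B₁ h₁ B₂ h₂ hne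
  obtain ⟨x₁, -, rfl⟩ := exists_eq_block_of_mem_blocksOf h₁
  obtain ⟨x₂, -, rfl⟩ := exists_eq_block_of_mem_blocksOf h₂
  refine disjoint_blocksOf (isPolymer_block b' x₁ |>.of_dvd hbb) ((isPolymer_block b' x₂).of_dvd hbb) ?_
  rw [Finset.disjoint_left]
  intro y hy₁ hy₂
  exact hne (by rw [← block_eq_of_mem hy₁, ← block_eq_of_mem hy₂])

/-- `|X| = Σ_{B ∈ ℬ(X)} |B|` (sites) for a polymer. [folklore] -/
theorem card_eq_sum_card_blocksOf {b : ℕ} {X : Finset (TorusSite d M)} (hX : IsPolymer b X) :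
    X.card = ∑ B ∈ blocksOf b X, B.card := by
  classical
  conv_lhs => rw [hX.eq_biUnion]
  rw [Finset.card_biUnion]
  · rfl
  · intro B₁ h₁ B₂ h₂ hne
    obtain ⟨x₁, -, rfl⟩ := exists_eq_block_of_mem_blocksOf h₁
    obtain ⟨x₂, -, rfl⟩ := exists_eq_block_of_mem_blocksOf h₂
    simp only [id_eq, Function.onFun]
    rw [Finset.disjoint_left]
    intro y hy₁ hy₂
    exact hne (by rw [← block_eq_of_mem hy₁, ← block_eq_of_mem hy₂])

/-- **Pulling a constant per site out of the background**: `(c^{|·|} I)^X = c^{|X|} I^X`. [folklore] -/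
theorem blockProd_pow_card_mul {b : ℕ} (c : A) (I : Finset (TorusSite d M) → A) {X : Finset (TorusSite d M)}
    (hX : IsPolymer b X) : blockProd b (fun B => c ^ B.card * I B) X = c ^ X.card * blockProd b I X := by
  unfold blockProd
  rw [Finset.prod_mul_distrib, Finset.prod_pow_eq_pow_sum, card_eq_sum_card_blocksOf hX]

/-- **Map 6 for the constant monomial** (Slade: `V_pt = V₊ + δu₊`, no gradient or observable
terms): pulling `e^{-δu₊|X|}` out of the circle product,
`((c^{|·|}I₊) ∘ K)(Λ) = c^{|Λ|} (I₊ ∘ (c'^{|·|}K))(Λ)` for `c c' = 1`; this is how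
`𝔼₊θ(I ∘ K)(Λ) = e^{-δu₊|Λ|}(I₊ ∘ K₊)(Λ)` acquires its prefactor. [cite: Slade2017, §6.3 (display "𝔼₊θ(I ∘ K)(Λ) = e^{-δu₊|Λ|}(I₊ ∘ K₊)(Λ)" and U₊ = (δu₊, V₊))] [cite: BrydgesSlade2015RGV, §6.2 (Map 6: "extracts δq σσ̄ from I_pt⁺ to bring it out of the circle product")] -/
theorem circ_blockProd_pow_card_mul {b : ℕ} (c c' : A) (hcc : c * c' = 1) (I K : Finset (TorusSite d M) → A) :
    circ b (blockProd b (fun B => c ^ B.card * I B)) K univ =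
      c ^ (univ : Finset (TorusSite d M)).card * circ b (blockProd b I) (fun U => c' ^ U.card * K U) univ := by
  classical
  rw [circ_blockProd_univ_eq, circ_blockProd_univ_eq, Finset.mul_sum]
  refine Finset.sum_congr rfl fun U hU => ?_
  have hUp : IsPolymer b U := (mem_subpolymers.1 hU).2
  rw [blockProd_pow_card_mul c I ((isPolymer_univ b).sdiff hUp), Finset.card_sdiff_of_subset (subset_univ U)]
  have hle : U.card ≤ (univ : Finset (TorusSite d M)).card := Finset.card_le_univ U
  have key : c ^ ((univ : Finset (TorusSite d M)).card - U.card) = c ^ (univ : Finset (TorusSite d M)).card * c' ^ U.card := by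
    have : c ^ (univ : Finset (TorusSite d M)).card = c ^ ((univ : Finset (TorusSite d M)).card - U.card) * c ^ U.card := by
      rw [← pow_add, Nat.sub_add_cancel hle]
    rw [this, mul_assoc, ← mul_pow, hcc, one_pow, mul_one]
  rw [key]
  ring

variable (b b' : ℕ) (ι θ : A →+* N) (E : N → A)

/-- The data of one renormalisation group step (Slade §6.3 / [BS-rg-step] §3.1), abstracted:
the interactions `I = I_j(V)`, `Î = I_j(V̂)`, `Ĩ_pt` (on `j`-blocks), `I_pt⁺`, `I₊ = I_{j+1}(V₊)` (on
`(j+1)`-blocks), the Map-1 transfer `J` (from `Loc`), the Map-4 transfer `h = h_ldg`, and the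
constants `c = e^{-δu₊}`, `c' = e^{δu₊}`. [cite: BrydgesSlade2015RGV, §3.1 ((3.1)–(3.7))] [cite: Slade2017, §6.3] -/
structure StepData (A : Type*) (d M : ℕ) where
  /-- `I_j(V, b)` on `j`-blocks -/
  I : Finset (TorusSite d M) → A
  /-- `Î = I_j(V̂, b)` on `j`-blocks -/
  Ihat : Finset (TorusSite d M) → A
  /-- `Ĩ_pt(b) = Ĩ_{j+1}(V_pt, b)` on `j`-blocks -/
  Itil : Finset (TorusSite d M) → A
  /-- `I_pt⁺(B)` on `(j+1)`-blocks -/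
  Iplus' : Finset (TorusSite d M) → A
  /-- `I₊ = I_{j+1}(V₊, B)` on `(j+1)`-blocks -/
  Iplus : Finset (TorusSite d M) → A
  /-- Map 1 transfer `J(X, B)` -/
  J : Finset (TorusSite d M) → Finset (TorusSite d M) → A
  /-- Map 4 transfer `h_ldg(U, B)` -/
  h : Finset (TorusSite d M) → Finset (TorusSite d M) → A
  /-- `c = e^{-δu₊}` -/
  c : A
  /-- `c' = e^{δu₊}` -/
  c' : A

variable (D : StepData A d M) (K : Finset (TorusSite d M) → A)

/-- **Map 1**: `K^{(1)} = K_out(I, K, J)` (transfer from small sets to blocks). [cite: BrydgesSlade2015RGV, §4.2 (Map 1, Lemma (lem:K1))] -/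
def kOne : Finset (TorusSite d M) → A := kout b D.I K D.J

/-- **Map 2**: `K^{(2)} = K^{(1)} ∘ δI^{(2)}`, `δI^{(2)} = I - Î`. [cite: BrydgesSlade2015RGV, §4.3 ((4.27))] -/
def kTwo : Finset (TorusSite d M) → A := circ b (kOne b D K) (blockProd b (D.I - D.Ihat))

/-- **Map 3**: `K^{(3)}` of (EIK2). [cite: BrydgesSlade2015RGV, §5.1 (Proposition (prop:K3))] -/
def kThree : Finset (TorusSite d M) → A := kthree b b' ι θ E D.Ihat D.Itil (kTwo b D K)

/-- **Map 4**: `K^{(4)} = K_out(Ĩ_pt, K^{(3)}, h_ldg)` at scale `j+1` (reapportionment). [cite: BrydgesSlade2015RGV, §5.3 (Map 4, Lemma (lem:K5a))] -/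
def kFour : Finset (TorusSite d M) → A := kout b' (fun B => blockProd b D.Itil B) (kThree b b' ι θ E D K) D.h

/-- **Map 5**: `K^{(5)} = K^{(4)} ∘ δ⁺I`, `δ⁺I = Ĩ_pt - I_pt⁺` on `(j+1)`-blocks. [cite: BrydgesSlade2015RGV, §6.1 (Map 5, (6.8))] -/
def kFive : Finset (TorusSite d M) → A :=
  circ b' (kFour b b' ι θ E D K) (blockProd b' ((fun B => blockProd b D.Itil B) - D.Iplus'))

/-- **Map 6 (Slade's version)**: `K₊(U) = e^{δu₊|U|} K^{(5)}(U)`. [cite: BrydgesSlade2015RGV, §6.2 (Map 6)] [cite: Slade2017, §6.3 (U₊ = (δu₊, V₊))] -/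
def kPlus : Finset (TorusSite d M) → A := fun U => D.c' ^ U.card * kFive b b' ι θ E D K U

/-- **The RG map preserves the circle-product representation** ([BS-rg-step] (3.2)–(3.7) ⇒
(e:rgmapdef-bis); Slade §6.3: "`K₊ = K₊(V,K)` … with the property that
`𝔼₊θ(I ∘ K)(Λ) = e^{-δu₊|Λ|}(I₊ ∘ K₊)(Λ)`"), for the composite `K₊ = Map 6 ∘ ⋯ ∘ Map 1 (K)`.
Hypotheses: `K` factorises over components (scale `j`); `J` is supported on `𝒟_j`; `E` is
`𝒩`-linear on admissible combinations and the Map-3 terms are admissible; `K^{(3)}` factorises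
over components at scale `j+1` (from the finite-range property, `kthree_eq_prod_components`); `h`
is supported on `𝒟_{j+1}`; `I_pt⁺(B) = e^{-δu₊|B|} I₊(B)` and `e^{-δu₊}e^{δu₊} = 1`; `L^j ∣ L^{j+1}`.
[cite: BrydgesSlade2015RGV, §3.1 ((3.2)–(3.8)) with Lemmas (lem:K1)(i), (lem:K2)(i), Proposition (prop:K3), Lemmas (lem:K5a)(i), (lem:K5)(i), (lem:K6)] [cite: Slade2017, §6.3 (defining property of (U₊, K₊))] -/
theorem expect_theta_circ_eq_kPlus (hbb : b ∣ b')
    (hK : ∀ X, IsPolymer b X → K X = ∏ Y ∈ components X, K Y)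
    (hJ : ∀ U B, D.J U B ≠ 0 → IsSmall b U ∧ B ∈ blocksOf b U)
    (P : N → Prop)
    (hE : ∀ (s : Finset (Finset (TorusSite d M))) (a : Finset (TorusSite d M) → A) (n : Finset (TorusSite d M) → N),
      (∀ i ∈ s, P (n i)) → E (∑ i ∈ s, ι (a i) * n i) = ∑ i ∈ s, a i * E (n i))
    (hP : ∀ Y, IsPolymer b Y → P (circ b (blockProd b (deltaI ι θ D.Ihat D.Itil)) (fun X => θ (kTwo b D K X)) Y))
    (hK3 : ∀ X, IsPolymer b' X → kThree b b' ι θ E D K X = ∏ Y ∈ components X, kThree b b' ι θ E D K Y)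
    (hh : ∀ U B, D.h U B ≠ 0 → IsSmall b' U ∧ B ∈ blocksOf b' U)
    (hI : ∀ x, D.Iplus' (block b' x) = D.c ^ (block b' x).card * D.Iplus (block b' x))
    (hcc : D.c * D.c' = 1) :
    E (θ (circ b (blockProd b D.I) K univ)) =
      D.c ^ (univ : Finset (TorusSite d M)).card * circ b' (blockProd b' D.Iplus) (kPlus b b' ι θ E D K) univ := by
  -- Map 1
  rw [← circ_blockProd_kout_univ b D.I K D.J hK hJ]
  -- Map 2
  rw [circ_blockProd_eq_circ_blockProd_circ_sub D.I D.Ihat (kout b D.I K D.J) (isPolymer_univ b)]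
  -- Map 3
  rw [show circ b (kout b D.I K D.J) (blockProd b (D.I - D.Ihat)) = kTwo b D K from rfl,
    expect_theta_circ_eq_circ_kthree b b' ι θ E hbb P hE D.Ihat D.Itil (kTwo b D K) hP,
    show kthree b b' ι θ E D.Ihat D.Itil (kTwo b D K) = kThree b b' ι θ E D K from rfl]
  -- rescale the background to `(j+1)`-blocks
  rw [circ_congr_left (fun X hX => blockProd_refine hbb D.Itil hX)]
  -- Map 4
  rw [← circ_blockProd_kout_univ b' (fun B => blockProd b D.Itil B) (kThree b b' ι θ E D K) D.h hK3 hh,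
    show kout b' (fun B => blockProd b D.Itil B) (kThree b b' ι θ E D K) D.h = kFour b b' ι θ E D K from rfl]
  -- Map 5
  rw [circ_blockProd_eq_circ_blockProd_circ_sub (fun B => blockProd b D.Itil B) D.Iplus' (kFour b b' ι θ E D K)
    (isPolymer_univ b'),
    show circ b' (kFour b b' ι θ E D K) (blockProd b' ((fun B => blockProd b D.Itil B) - D.Iplus')) =
      kFive b b' ι θ E D K from rfl]
  -- Map 6
  have hI' : ∀ X, IsPolymer b' X → blockProd b' D.Iplus' X = blockProd b' (fun B => D.c ^ B.card * D.Iplus B) X := by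
    intro X _
    unfold blockProd
    refine Finset.prod_congr rfl fun B hB => ?_
    obtain ⟨x, -, rfl⟩ := exists_eq_block_of_mem_blocksOf hB
    exact hI x
  rw [circ_congr_left hI', circ_blockProd_pow_card_mul D.c D.c' hcc]
  rfl

end Composite

end Polymer

end LongRangePhi4

end Literature.Barriers.CriticalPhenomena
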